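import Mathlib.Analysis.Calculus.MeanValue
import Mathlib.Analysis.Calculus.Deriv.Pow
import Mathlib.Analysis.Calculus.Deriv.Mul
import Mathlib.Analysis.SpecificLimits.Normed
import Mathlib.Analysis.Normed.Operator.ContinuousLinearMap
import Literature.Analysis.Calculus.NewtonKantorovich
import HarnessLib

/-!
# The Newton–Kantorovich theorem (affine covariant form) — proofs

Topic `Literature/Analysis/Calculus`.  This file DISCHARGES the two named facts of
`NewtonKantorovich.lean`:

* `NewtonKantorovich_holds : NewtonKantorovich` — P. Deuflhard, *Newton Methods for Nonlinear
  Problems* (2011) [Deuflhard2011], §2.1.1 **Theorem 2.1** (L. V. Kantorovich 1948): under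
  `‖F'(x⁰)⁻¹F(x⁰)‖ ≤ α`, `‖F'(x⁰)⁻¹(F'(y) − F'(x))‖ ≤ ω̄₀‖y − x‖` on the open convex `D`,
  `h₀ = αω̄₀ ≤ 1/2` and `S̄(x⁰, ρ₋) ⊆ D`, `ρ₋ = (1 − √(1 − 2h₀))/ω̄₀`, the ordinary Newton iterates are
  well defined, stay in `S̄(x⁰, ρ₋)` and converge to a zero `x*` of `F` in that ball;
* `NewtonKantorovichUniqueness_holds : NewtonKantorovichUniqueness` — ibid. **Remark 2.1**
  (Kantorovich–Akilov; Ortega–Rheinboldt Thm. 12.6.2): if moreover `S̄(x⁰, ρ₊) ⊆ D`,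
  `ρ₊ = (1 + √(1 − 2h₀))/ω̄₀`, that zero is the only zero of `F` in the open ball `S(x⁰, ρ₊)`.

## The proof written here
Deuflhard (held copy, chunks 50–51) only *sketches* a proof ("an alternative affine covariant proof,
which dates back to T. Yamamoto"), by induction on the iterates with the majorants `h_k`,
`β_{k+1} = 1/(1 − h_k)`, `h_k = ½ h_{k−1}²/(1 − h_{k−1})²`; the containment in `S̄(x⁰, ρ₋)` and the
limiting case `h₀ = 1/2` are left to the reader, and the uniqueness proof "is omitted here".  We give a
complete argument along the same lines (induction on the Kantorovich hypotheses, no scalar majorant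
sequence), which we record since it is, to our knowledge, the shortest fully rigorous route:

1. *Averaged Lipschitz remainder* (`norm_remainder_le`): for `a, b, c ∈ D` and any `G'` with
   `‖G'(F'(v) − F'(u))‖ ≤ ω'‖v − u‖` on `D`,
   `‖G'(F(b) − F(a) − F'(c)(b − a))‖ ≤ (ω'/2)(‖a − c‖ + ‖b − c‖)‖b − a‖`
   (fencing argument along the segment, `image_norm_le_of_norm_deriv_right_le_deriv_boundary`;
   `c = a` is the usual `(ω'/2)‖b − a‖²`).
2. *One step* (`stage_step`): if the hypotheses hold at `x` with a two-sided inverse `G'` of `F'(x)`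
   and constants `(α', ω')`, `h' = α'ω' ≤ 1/2`, and `S̄(x, ρ(α', ω')) ⊆ D`, then at the Newton iterate
   `x⁺ = x − G'F(x)` (`‖x⁺ − x‖ ≤ α'`) the map `F'(x⁺)` has the two-sided inverse
   `G⁺ = (G'F'(x⁺))⁻¹G'` (Neumann series, `‖I − G'F'(x⁺)‖ ≤ ω'‖x⁺ − x‖ ≤ h' < 1`,
   `‖(G'F'(x⁺))⁻¹‖ ≤ 1/(1 − h')`), and the hypotheses hold again with
   `α⁺ = α'h'/(2(1 − h'))` (by 1., `‖G'F(x⁺)‖ ≤ (ω'/2)‖x⁺ − x‖²`), `ω⁺ = ω'/(1 − h')`,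
   `h⁺ = h'²/(2(1 − h')²) ≤ 1/2`.
3. *Exact nesting of the Kantorovich balls* (`rad_next`): with `ρ(α, ω) = (1 − √(1 − 2αω))/ω` one has
   the identity `ρ(α⁺, ω⁺) + α' = ρ(α', ω')` (because `1 − 2h⁺ = (1 − 2h')/(1 − h')²`), hence
   `S̄(x⁺, ρ⁺) ⊆ S̄(x, ρ')` and, inductively, `‖xᵏ − x⁰‖ + ρ_k ≤ ρ₋`: all iterates and all balls stay in
   `S̄(x⁰, ρ₋) ⊆ D`, so 2. applies at every step.
4. *Convergence*: `α⁺ ≤ α'/2`, so `‖xᵏ⁺¹ − xᵏ‖ ≤ α_k ≤ α 2⁻ᵏ`; the iterates are Cauchy, converge to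
   some `x*` of the closed ball, and `‖F'(x⁰)⁻¹F(xᵏ⁺¹)‖ ≤ (ω̄₀/2)‖xᵏ⁺¹ − xᵏ‖² → 0` (by 1. and the
   Newton equation) gives `F(x*) = 0` by continuity of `F` at `x* ∈ D`.
5. *Uniqueness*: if `F(y) = 0`, `‖y − x⁰‖ < ρ₊`, then by 1. with `c = x⁰`,
   `‖y − x*‖ = ‖F'(x⁰)⁻¹(F(y) − F(x*) − F'(x⁰)(y − x*))‖ ≤ (ω̄₀/2)(‖x* − x⁰‖ + ‖y − x⁰‖)‖y − x*‖`
   and `(ω̄₀/2)(ρ₋ + ρ₊) = 1`, so the factor is `< 1` and `y = x*` (this covers `h₀ = 1/2` too).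

No new definitions are exported (the iterates `newtonSeq`, the constants `consts` and the invariant
`Stage` are private); besides the two discharges we export the instance-level statements
`KantorovichData.newtonKantorovich` and `KantorovichData.eq_of_zero_of_mem_ball` they are assembled
from.

## References
* [Deuflhard2011] P. Deuflhard, Newton Methods for Nonlinear Problems, Springer Ser. Comput. Math. 35
  (2011), §2.1.1 Thm. 2.1, Rem. 2.1 (held copy
  `lit read book:deuflhard2011-newton-methods-nonlinear-problems`, chunks 50–51).
* L. V. Kantorovich, Dokl. Akad. Nauk SSSR 59 (1948) 1237–1240; L. V. Kantorovich, G. P. Akilov,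
  Functional Analysis, Ch. XVIII; J. M. Ortega, W. C. Rheinboldt, Iterative Solution of Nonlinear
  Equations in Several Variables (1970), Thm. 12.6.2; T. Yamamoto, Numer. Math. 49 (1986) 203–220.

AI-produced formalisation (H21 engines group, seat eng-cap-2, 2026-08-20).
-/

set_option autoImplicit false

noncomputable section

open Metric Set Filter
open scoped Topology

namespace Literature.Analysis.Calculus

namespace KantorovichData

variable {X Y : Type*} [NormedAddCommGroup X] [NormedSpace ℝ X] [CompleteSpace X]
  [NormedAddCommGroup Y] [NormedSpace ℝ Y] [CompleteSpace Y] (d : KantorovichData X Y)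

/-! ### 1. The averaged affine covariant Lipschitz remainder -/

/-- For `a, b, c ∈ D`: `‖G'(F(b) − F(a) − F'(c)(b − a))‖ ≤ (ω'/2)(‖a − c‖ + ‖b − c‖)‖b − a‖`
whenever `‖G' ∘ (F'(v) − F'(u))‖ ≤ ω'‖v − u‖` on `D`. [folklore] -/
private theorem norm_remainder_le {G' : Y →L[ℝ] X} {ω' : ℝ} (hω : 0 ≤ ω')
    (hlip : ∀ u ∈ d.D, ∀ v ∈ d.D, ‖G'.comp (d.F' v - d.F' u)‖ ≤ ω' * ‖v - u‖)
    {a b c : X} (ha : a ∈ d.D) (hb : b ∈ d.D) (hc : c ∈ d.D) :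
    ‖G' (d.F b - d.F a - d.F' c (b - a))‖ ≤ ω' / 2 * (‖a - c‖ + ‖b - c‖) * ‖b - a‖ := by
  set e : X := b - a with he
  have hseg : ∀ s ∈ Icc (0 : ℝ) 1, a + s • e ∈ d.D := fun s hs =>
    d.convex_D.add_smul_sub_mem ha hb hs
  set A : ℝ := ‖a - c‖ with hA
  set B : ℝ := ‖b - c‖ with hB
  -- the auxiliary function along the segment and its derivative
  have hder : ∀ s ∈ Icc (0 : ℝ) 1,
      HasDerivAt (fun t : ℝ => G' (d.F (a + t • e)) - G' (d.F a) - t • G' (d.F' c e))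
        (G' (d.F' (a + s • e) e) - G' (d.F' c e)) s := by
    intro s hs
    have hp : HasDerivAt (fun t : ℝ => a + t • e) e s := by
      simpa using ((hasDerivAt_id s).smul_const e).const_add a
    have h1 : HasDerivAt (fun t : ℝ => G' (d.F (a + t • e))) (G' (d.F' (a + s • e) e)) s := by
      have := G'.hasFDerivAt.comp_hasDerivAt s
        ((d.hasFDerivAt _ (hseg s hs)).comp_hasDerivAt s hp)
      simpa [Function.comp_def] using this
    have h2 : HasDerivAt (fun t : ℝ => t • G' (d.F' c e)) (G' (d.F' c e)) s := by
      simpa using (hasDerivAt_id s).smul_const (G' (d.F' c e))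
    exact (h1.sub_const (G' (d.F a))).sub h2
  -- the bound on the derivative
  have hbound : ∀ s ∈ Ico (0 : ℝ) 1,
      ‖G' (d.F' (a + s • e) e) - G' (d.F' c e)‖ ≤ ω' * ‖e‖ * ((1 - s) * A + s * B) := by
    intro s hs
    have hs0 : 0 ≤ s := hs.1
    have hs1 : s ≤ 1 := hs.2.le
    have hmem : a + s • e ∈ d.D := hseg s ⟨hs0, hs1⟩
    have hcomp :
        G' (d.F' (a + s • e) e) - G' (d.F' c e) = (G'.comp (d.F' (a + s • e) - d.F' c)) e := by
      simp
    have hn : ‖a + s • e - c‖ ≤ (1 - s) * A + s * B := by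
      have hsplit : a + s • e - c = (1 - s) • (a - c) + s • (b - c) := by
        rw [he]
        simp only [smul_sub, sub_smul, one_smul]
        abel
      rw [hsplit]
      calc ‖(1 - s) • (a - c) + s • (b - c)‖ ≤ ‖(1 - s) • (a - c)‖ + ‖s • (b - c)‖ :=
            norm_add_le _ _
        _ = (1 - s) * A + s * B := by
            rw [norm_smul, norm_smul, Real.norm_of_nonneg (by linarith), Real.norm_of_nonneg hs0]
    calc ‖G' (d.F' (a + s • e) e) - G' (d.F' c e)‖
        = ‖(G'.comp (d.F' (a + s • e) - d.F' c)) e‖ := by rw [hcomp]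
      _ ≤ ‖G'.comp (d.F' (a + s • e) - d.F' c)‖ * ‖e‖ := ContinuousLinearMap.le_opNorm _ _
      _ ≤ ω' * ‖a + s • e - c‖ * ‖e‖ :=
          mul_le_mul_of_nonneg_right (hlip c hc _ hmem) (norm_nonneg _)
      _ ≤ ω' * ((1 - s) * A + s * B) * ‖e‖ :=
          mul_le_mul_of_nonneg_right (mul_le_mul_of_nonneg_left hn hω) (norm_nonneg _)
      _ = ω' * ‖e‖ * ((1 - s) * A + s * B) := by ring
  -- the majorant `s ↦ ω'‖e‖(sA + s²(B − A)/2)` and its derivative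
  have hmaj : ∀ s : ℝ, HasDerivAt (fun t : ℝ => ω' * ‖e‖ * (t * A + t ^ 2 / 2 * (B - A)))
      (ω' * ‖e‖ * ((1 - s) * A + s * B)) s := by
    intro s
    have hsq : HasDerivAt (fun t : ℝ => t ^ 2) (2 * s) s := by
      simpa using hasDerivAt_pow 2 s
    have h1 : HasDerivAt (fun t : ℝ => t * A + t ^ 2 / 2 * (B - A))
        (A + 2 * s / 2 * (B - A)) s :=
      (hasDerivAt_mul_const A).add ((hsq.div_const 2).mul_const (B - A))
    exact (h1.const_mul (ω' * ‖e‖)).congr_deriv (by ring)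
  -- fencing
  have hcont : ContinuousOn (fun t : ℝ => G' (d.F (a + t • e)) - G' (d.F a) - t • G' (d.F' c e))
      (Icc 0 1) := fun s hs => (hder s hs).continuousAt.continuousWithinAt
  have hfence := image_norm_le_of_norm_deriv_right_le_deriv_boundary hcont
    (fun s hs => (hder s (Ico_subset_Icc_self hs)).hasDerivWithinAt) (by simp) hmaj hbound
    (right_mem_Icc.2 zero_le_one)
  have hval : G' (d.F (a + (1 : ℝ) • e)) - G' (d.F a) - (1 : ℝ) • G' (d.F' c e) =
      G' (d.F b - d.F a - d.F' c (b - a)) := by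
    simp only [one_smul, map_sub, he, add_sub_cancel]
  rw [hval] at hfence
  calc ‖G' (d.F b - d.F a - d.F' c (b - a))‖ ≤ ω' * ‖e‖ * (1 * A + 1 ^ 2 / 2 * (B - A)) := hfence
    _ = ω' / 2 * (‖a - c‖ + ‖b - c‖) * ‖b - a‖ := by rw [hA, hB, he]; ring

/-! ### The Banach perturbation lemma with the norm of the inverse -/

/-- If `‖I − M‖ ≤ q < 1` in `B(X)`, `X` Banach, then `M` has a two-sided inverse `N` with
`‖N‖ ≤ 1/(1 − q)` (Neumann series). [folklore] -/
private theorem exists_inverse_of_norm_id_sub_le {M : X →L[ℝ] X} {q : ℝ}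
    (hM : ‖ContinuousLinearMap.id ℝ X - M‖ ≤ q) (hq : q < 1) :
    ∃ N : X →L[ℝ] X, N.comp M = ContinuousLinearMap.id ℝ X ∧
      M.comp N = ContinuousLinearMap.id ℝ X ∧ ‖N‖ ≤ (1 - q)⁻¹ := by
  set T : X →L[ℝ] X := ContinuousLinearMap.id ℝ X - M with hT
  have hT1 : ‖T‖ < 1 := hM.trans_lt hq
  set u : (X →L[ℝ] X)ˣ := Units.oneSub T hT1 with hu
  have huM : (u : X →L[ℝ] X) = M := by
    rw [hu, Units.val_oneSub, hT, ← ContinuousLinearMap.one_def, sub_sub_cancel]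
  have hinv : ((u⁻¹ : (X →L[ℝ] X)ˣ) : X →L[ℝ] X) = ∑' n : ℕ, T ^ n := rfl
  refine ⟨(u⁻¹ : (X →L[ℝ] X)ˣ), ?_, ?_, ?_⟩
  · have h := u.inv_mul
    rw [huM] at h
    exact h
  · have h := u.mul_inv
    rw [huM] at h
    exact h
  · rw [hinv]
    have h1 := tsum_geometric_le_of_norm_lt_one T hT1
    have h2 : ‖(1 : X →L[ℝ] X)‖ ≤ 1 := ContinuousLinearMap.norm_id_le
    have h3 : (1 - ‖T‖)⁻¹ ≤ (1 - q)⁻¹ := inv_anti₀ (sub_pos.2 hq) (by linarith)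
    linarith

/-! ### The Kantorovich radius and the successor constants -/

/-- `ρ(α, ω) = (1 − √(1 − 2αω))/ω`. [folklore] -/
private def rad (α' ω' : ℝ) : ℝ := (1 - Real.sqrt (1 - 2 * (α' * ω'))) / ω'

/-- `α⁺ = α h/(2(1 − h))`, `h = αω`. [folklore] -/
private def nextα (α' ω' : ℝ) : ℝ := α' * (α' * ω') / (2 * (1 - α' * ω'))

/-- `ω⁺ = ω/(1 − h)`, `h = αω`. [folklore] -/
private def nextω (α' ω' : ℝ) : ℝ := ω' / (1 - α' * ω')

/-- `ρ₋ = ρ(α, ω̄₀)` by definition. [folklore] -/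
private theorem rhoMinus_eq_rad : d.rhoMinus = rad d.α d.ω := rfl

section Scalar

variable {α' ω' : ℝ}

/-- `α ≤ ρ(α, ω)` (since `√(1 − 2h) ≤ 1 − h`). [folklore] -/
private theorem le_rad (hω : 0 < ω') (hh : α' * ω' ≤ 1 / 2) : α' ≤ rad α' ω' := by
  have hs : Real.sqrt (1 - 2 * (α' * ω')) ≤ 1 - α' * ω' := by
    rw [Real.sqrt_le_left (by linarith)]
    nlinarith [sq_nonneg (α' * ω')]
  unfold rad
  rw [le_div_iff₀ hω]
  linarith

/-- `0 ≤ ρ(α, ω)`. [folklore] -/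
private theorem rad_nonneg (hα : 0 ≤ α') (hω : 0 < ω') (hh : α' * ω' ≤ 1 / 2) : 0 ≤ rad α' ω' :=
  hα.trans (le_rad hω hh)

/-- `0 ≤ α⁺`. [folklore] -/
private theorem nextα_nonneg (hα : 0 ≤ α') (hω : 0 < ω') (hh : α' * ω' ≤ 1 / 2) :
    0 ≤ nextα α' ω' := by
  unfold nextα
  exact div_nonneg (mul_nonneg hα (mul_nonneg hα hω.le)) (by linarith)

/-- `0 < ω⁺`. [folklore] -/
private theorem nextω_pos (hω : 0 < ω') (hh : α' * ω' ≤ 1 / 2) : 0 < nextω α' ω' := by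
  unfold nextω
  exact div_pos hω (by linarith)

/-- `α⁺ ≤ α/2` (as `h ≤ 1/2`). [folklore] -/
private theorem nextα_le_half (hα : 0 ≤ α') (hh : α' * ω' ≤ 1 / 2) :
    nextα α' ω' ≤ α' / 2 := by
  unfold nextα
  rw [div_le_iff₀ (by linarith)]
  nlinarith

/-- `h⁺ = α⁺ω⁺ = h²/(2(1 − h)²)`. [folklore] -/
private theorem next_prod :
    nextα α' ω' * nextω α' ω' = (α' * ω') ^ 2 / (2 * (1 - α' * ω') ^ 2) := by
  unfold nextα nextω
  rw [div_mul_div_comm]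
  congr 1 <;> ring

/-- `h⁺ ≤ 1/2`. [folklore] -/
private theorem next_h_le (hh : α' * ω' ≤ 1 / 2) : nextα α' ω' * nextω α' ω' ≤ 1 / 2 := by
  rw [next_prod, div_le_iff₀ (by nlinarith)]
  nlinarith

/-- The exact nesting identity `ρ(α⁺, ω⁺) + α = ρ(α, ω)`. [folklore] -/
private theorem rad_next (hω : 0 < ω') (hh : α' * ω' ≤ 1 / 2) :
    rad (nextα α' ω') (nextω α' ω') + α' = rad α' ω' := by
  have h1 : 0 < 1 - α' * ω' := by linarith
  have h0 : 0 ≤ 1 - 2 * (α' * ω') := by linarith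
  set s : ℝ := Real.sqrt (1 - 2 * (α' * ω')) with hsdef
  have hs0 : 0 ≤ s := Real.sqrt_nonneg _
  have hs2 : s ^ 2 = 1 - 2 * (α' * ω') := Real.sq_sqrt h0
  have hinner : 1 - 2 * (nextα α' ω' * nextω α' ω') = (s / (1 - α' * ω')) ^ 2 := by
    rw [next_prod, div_pow, hs2]
    field_simp
    ring
  have hsqrt : Real.sqrt (1 - 2 * (nextα α' ω' * nextω α' ω')) = s / (1 - α' * ω') := by
    rw [hinner, Real.sqrt_sq (div_nonneg hs0 h1.le)]
  have hL : rad (nextα α' ω') (nextω α' ω') = (1 - α' * ω' - s) / ω' := by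
    unfold rad
    rw [hsqrt]
    unfold nextω
    field_simp
  have hR : rad α' ω' = (1 - s) / ω' := by
    unfold rad
    rw [hsdef]
  rw [hL, hR]
  field_simp
  ring

end Scalar

/-! ### 2. The invariant and one Newton step -/

/-- The Kantorovich hypotheses at a point `x` with inverse `G'` and constants `(α', ω')`.
[folklore] -/
private structure Stage (x : X) (G' : Y →L[ℝ] X) (α' ω' : ℝ) : Prop where
  mem : x ∈ d.D
  linv : G'.comp (d.F' x) = ContinuousLinearMap.id ℝ X
  rinv : (d.F' x).comp G' = ContinuousLinearMap.id ℝ Y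
  alpha : ‖G' (d.F x)‖ ≤ α'
  lip : ∀ u ∈ d.D, ∀ v ∈ d.D, ‖G'.comp (d.F' v - d.F' u)‖ ≤ ω' * ‖v - u‖
  α_nonneg : 0 ≤ α'
  ω_pos : 0 < ω'
  h_le : α' * ω' ≤ 1 / 2

/-- `G'(F'(x)v) = v`. [folklore] -/
private theorem Stage.apply_left {x : X} {G' : Y →L[ℝ] X} {α' ω' : ℝ} (hs : Stage d x G' α' ω')
    (v : X) : G' (d.F' x v) = v := by
  simpa using DFunLike.congr_fun hs.linv v

/-- `F'(x)(G'w) = w`. [folklore] -/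
private theorem Stage.apply_right {x : X} {G' : Y →L[ℝ] X} {α' ω' : ℝ} (hs : Stage d x G' α' ω')
    (w : Y) : d.F' x (G' w) = w := by
  simpa using DFunLike.congr_fun hs.rinv w

/-- One Newton step propagates the invariant with the successor constants. [folklore] -/
private theorem stage_step {x : X} {G' : Y →L[ℝ] X} {α' ω' : ℝ} (hs : Stage d x G' α' ω')
    (hball : closedBall x (rad α' ω') ⊆ d.D) :
    ∃ G'' : Y →L[ℝ] X, Stage d (x - G' (d.F x)) G'' (nextα α' ω') (nextω α' ω') := by
  set x' : X := x - G' (d.F x) with hx'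
  have h1h : 0 < 1 - α' * ω' := by linarith [hs.h_le]
  have hstep : ‖x' - x‖ ≤ α' := by
    simpa [hx'] using hs.alpha
  have hx'D : x' ∈ d.D := by
    apply hball
    rw [mem_closedBall, dist_eq_norm]
    exact hstep.trans (le_rad hs.ω_pos hs.h_le)
  -- the perturbed identity `M = G' F'(x')`
  set M : X →L[ℝ] X := G'.comp (d.F' x') with hM
  have hMI : ‖ContinuousLinearMap.id ℝ X - M‖ ≤ α' * ω' := by
    have hrw : ContinuousLinearMap.id ℝ X - M = -(G'.comp (d.F' x' - d.F' x)) := by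
      rw [ContinuousLinearMap.comp_sub, hs.linv, hM]
      abel
    rw [hrw, norm_neg]
    calc ‖G'.comp (d.F' x' - d.F' x)‖ ≤ ω' * ‖x' - x‖ := hs.lip x hs.mem x' hx'D
      _ ≤ ω' * α' := mul_le_mul_of_nonneg_left hstep hs.ω_pos.le
      _ = α' * ω' := mul_comm _ _
  obtain ⟨N, hNM, hMN, hN⟩ := exists_inverse_of_norm_id_sub_le hMI (by linarith [hs.h_le])
  -- the residual at `x'`
  have hGF : G' (d.F x') = G' (d.F x' - d.F x - d.F' x (x' - x)) := by
    rw [map_sub, map_sub, hs.apply_left d, hx']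
    abel
  have hres : ‖G' (d.F x')‖ ≤ ω' / 2 * α' ^ 2 := by
    have hrem := d.norm_remainder_le hs.ω_pos.le hs.lip hs.mem hx'D hs.mem
    rw [sub_self, norm_zero, zero_add] at hrem
    rw [hGF]
    refine hrem.trans ?_
    have h5 : ‖x' - x‖ ^ 2 ≤ α' ^ 2 := pow_le_pow_left₀ (norm_nonneg _) hstep 2
    calc ω' / 2 * ‖x' - x‖ * ‖x' - x‖ = ω' / 2 * ‖x' - x‖ ^ 2 := by ring
      _ ≤ ω' / 2 * α' ^ 2 := mul_le_mul_of_nonneg_left h5 (by linarith [hs.ω_pos])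
  refine ⟨N.comp G', ⟨hx'D, ?_, ?_, ?_, ?_, nextα_nonneg hs.α_nonneg hs.ω_pos hs.h_le,
    nextω_pos hs.ω_pos hs.h_le, next_h_le hs.h_le⟩⟩
  · -- left inverse
    rw [ContinuousLinearMap.comp_assoc]
    exact hNM
  · -- right inverse: `F'(x') = F'(x) ∘ M`
    have hFx' : d.F' x' = (d.F' x).comp M := by
      rw [hM, ← ContinuousLinearMap.comp_assoc, hs.rinv, ContinuousLinearMap.id_comp]
    rw [hFx', ContinuousLinearMap.comp_assoc, ← ContinuousLinearMap.comp_assoc M N G', hMN,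
      ContinuousLinearMap.id_comp, hs.rinv]
  · -- the new residual bound
    calc ‖(N.comp G') (d.F x')‖ = ‖N (G' (d.F x'))‖ := rfl
      _ ≤ ‖N‖ * ‖G' (d.F x')‖ := N.le_opNorm _
      _ ≤ (1 - α' * ω')⁻¹ * (ω' / 2 * α' ^ 2) :=
          mul_le_mul hN hres (norm_nonneg _) (inv_nonneg.2 h1h.le)
      _ = nextα α' ω' := by
          unfold nextα
          field_simp
  · -- the new Lipschitz constant
    intro u hu v hv
    calc ‖(N.comp G').comp (d.F' v - d.F' u)‖ = ‖N.comp (G'.comp (d.F' v - d.F' u))‖ := by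
          rw [ContinuousLinearMap.comp_assoc]
      _ ≤ ‖N‖ * ‖G'.comp (d.F' v - d.F' u)‖ := ContinuousLinearMap.opNorm_comp_le _ _
      _ ≤ (1 - α' * ω')⁻¹ * (ω' * ‖v - u‖) :=
          mul_le_mul hN (hs.lip u hu v hv) (norm_nonneg _) (inv_nonneg.2 h1h.le)
      _ = nextω α' ω' * ‖v - u‖ := by
          unfold nextω
          rw [div_eq_mul_inv]
          ring

/-! ### 3. The Newton iterates and the induction -/

/-- The Newton iterates, `xᵏ⁺¹ = xᵏ − F'(xᵏ)⁻¹ F(xᵏ)` (with `ContinuousLinearMap.inverse`).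
[folklore] -/
private def newtonSeq : ℕ → X
  | 0 => d.x0
  | k + 1 => newtonSeq k - (d.F' (newtonSeq k)).inverse (d.F (newtonSeq k))

/-- The constants `(α_k, ω_k)` along the iteration. [folklore] -/
private def consts : ℕ → ℝ × ℝ
  | 0 => (d.α, d.ω)
  | k + 1 => (nextα (consts k).1 (consts k).2, nextω (consts k).1 (consts k).2)

/-- The induction: the invariant at every iterate, together with the nesting
`‖xᵏ − x⁰‖ + ρ_k ≤ ρ₋`. [folklore] -/
private theorem stage_all (hball : closedBall d.x0 d.rhoMinus ⊆ d.D) (k : ℕ) :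
    ∃ G' : Y →L[ℝ] X, Stage d (d.newtonSeq k) G' (d.consts k).1 (d.consts k).2 ∧
      ‖d.newtonSeq k - d.x0‖ + rad (d.consts k).1 (d.consts k).2 ≤ rad d.α d.ω := by
  induction k with
  | zero =>
    refine ⟨d.G, ⟨d.x0_mem, ContinuousLinearMap.ext d.G_left, ContinuousLinearMap.ext d.G_right,
      d.norm_G_F_le, d.lipschitz, (norm_nonneg _).trans d.norm_G_F_le, d.ω_pos, d.h0_le⟩, ?_⟩
    simp [newtonSeq, consts]
  | succ k ih =>
    obtain ⟨G', hs, hdist⟩ := ih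
    have hballk : closedBall (d.newtonSeq k) (rad (d.consts k).1 (d.consts k).2) ⊆ d.D := by
      intro z hz
      apply hball
      rw [mem_closedBall, dist_eq_norm] at hz ⊢
      rw [rhoMinus_eq_rad]
      calc ‖z - d.x0‖ ≤ ‖z - d.newtonSeq k‖ + ‖d.newtonSeq k - d.x0‖ :=
            norm_sub_le_norm_sub_add_norm_sub _ _ _
        _ ≤ rad d.α d.ω := by linarith
    obtain ⟨G'', hs'⟩ := d.stage_step hs hballk
    have hinv : (d.F' (d.newtonSeq k)).inverse = G' :=
      ContinuousLinearMap.inverse_eq hs.rinv hs.linv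
    have hxk1 : d.newtonSeq (k + 1) = d.newtonSeq k - G' (d.F (d.newtonSeq k)) := by
      change d.newtonSeq k - (d.F' (d.newtonSeq k)).inverse (d.F (d.newtonSeq k)) = _
      rw [hinv]
    refine ⟨G'', ?_, ?_⟩
    · rw [hxk1]
      exact hs'
    · have hstep : ‖d.newtonSeq (k + 1) - d.newtonSeq k‖ ≤ (d.consts k).1 := by
        rw [hxk1]
        simpa using hs.alpha
      have hnest := rad_next hs.ω_pos hs.h_le
      have hrk : rad (d.consts (k + 1)).1 (d.consts (k + 1)).2 =
          rad (nextα (d.consts k).1 (d.consts k).2) (nextω (d.consts k).1 (d.consts k).2) := rfl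
      rw [hrk]
      have htri := norm_sub_le_norm_sub_add_norm_sub (d.newtonSeq (k + 1)) (d.newtonSeq k) d.x0
      linarith

/-- The step lengths: `‖xᵏ⁺¹ − xᵏ‖ ≤ α_k ≤ α/2ᵏ`. [folklore] -/
private theorem norm_step_le (hball : closedBall d.x0 d.rhoMinus ⊆ d.D) (k : ℕ) :
    ‖d.newtonSeq (k + 1) - d.newtonSeq k‖ ≤ (d.consts k).1 := by
  obtain ⟨G', hs, -⟩ := d.stage_all hball k
  have hinv : (d.F' (d.newtonSeq k)).inverse = G' := ContinuousLinearMap.inverse_eq hs.rinv hs.linv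
  have hxk1 : d.newtonSeq (k + 1) = d.newtonSeq k - G' (d.F (d.newtonSeq k)) := by
    change d.newtonSeq k - (d.F' (d.newtonSeq k)).inverse (d.F (d.newtonSeq k)) = _
    rw [hinv]
  rw [hxk1]
  simpa using hs.alpha

/-- `α_k ≤ α/2ᵏ`. [folklore] -/
private theorem consts_fst_le (hball : closedBall d.x0 d.rhoMinus ⊆ d.D) (k : ℕ) :
    (d.consts k).1 ≤ d.α / 2 ^ k := by
  induction k with
  | zero => simp [consts]
  | succ k ih =>
    obtain ⟨G', hs, -⟩ := d.stage_all hball k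
    calc (d.consts (k + 1)).1 = nextα (d.consts k).1 (d.consts k).2 := rfl
      _ ≤ (d.consts k).1 / 2 := nextα_le_half hs.α_nonneg hs.h_le
      _ ≤ d.α / 2 ^ k / 2 := by gcongr
      _ = d.α / 2 ^ (k + 1) := by rw [pow_succ]; ring

/-! ### 4. The theorem for one `KantorovichData` -/

/-- **Newton–Kantorovich for the data `d`** (Deuflhard 2011, Thm. 2.1): if `S̄(x⁰, ρ₋) ⊆ D` then the
Newton iterates are well defined, stay in `S̄(x⁰, ρ₋)` and converge to a zero of `F` in that ball.
[cite: Deuflhard2011, §2.1.1 Thm 2.1] -/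
theorem newtonKantorovich (hball : closedBall d.x0 d.rhoMinus ⊆ d.D) :
    ∃ x : ℕ → X, d.IsNewtonSequence x ∧ (∀ k, x k ∈ closedBall d.x0 d.rhoMinus) ∧
      ∃ xstar ∈ closedBall d.x0 d.rhoMinus, d.F xstar = 0 ∧ Tendsto x atTop (𝓝 xstar) := by
  have hmem : ∀ k, d.newtonSeq k ∈ closedBall d.x0 d.rhoMinus := by
    intro k
    obtain ⟨G', hs, hdist⟩ := d.stage_all hball k
    rw [mem_closedBall, dist_eq_norm, rhoMinus_eq_rad]
    linarith [rad_nonneg hs.α_nonneg hs.ω_pos hs.h_le]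
  have hnewton : d.IsNewtonSequence d.newtonSeq := by
    refine ⟨rfl, fun k => ?_⟩
    obtain ⟨G', hs, -⟩ := d.stage_all hball k
    have hinv : (d.F' (d.newtonSeq k)).inverse = G' :=
      ContinuousLinearMap.inverse_eq hs.rinv hs.linv
    have hxk1 : d.newtonSeq (k + 1) = d.newtonSeq k - G' (d.F (d.newtonSeq k)) := by
      change d.newtonSeq k - (d.F' (d.newtonSeq k)).inverse (d.F (d.newtonSeq k)) = _
      rw [hinv]
    refine ⟨ContinuousLinearMap.IsInvertible.of_inverse hs.rinv hs.linv, ?_⟩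
    rw [hxk1, sub_sub_cancel_left, map_neg, hs.apply_right d]
  -- Cauchy ⇒ convergent
  have hcauchy : CauchySeq d.newtonSeq := by
    refine cauchySeq_of_le_geometric_two (C := 2 * d.α) fun k => ?_
    rw [dist_comm, dist_eq_norm]
    calc ‖d.newtonSeq (k + 1) - d.newtonSeq k‖ ≤ (d.consts k).1 := d.norm_step_le hball k
      _ ≤ d.α / 2 ^ k := d.consts_fst_le hball k
      _ = 2 * d.α / 2 / 2 ^ k := by ring
  obtain ⟨xstar, hx⟩ := cauchySeq_tendsto_of_complete hcauchy
  have hstar : xstar ∈ closedBall d.x0 d.rhoMinus :=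
    isClosed_closedBall.mem_of_tendsto hx (Eventually.of_forall hmem)
  refine ⟨d.newtonSeq, hnewton, hmem, xstar, hstar, ?_, hx⟩
  -- `F(x*) = 0`: the preconditioned residuals tend to zero
  have hres : ∀ k, ‖d.G (d.F (d.newtonSeq (k + 1)))‖ ≤ d.ω / 2 * (d.α / 2 ^ k) ^ 2 := by
    intro k
    have hk : d.newtonSeq k ∈ d.D := hball (hmem k)
    have hk1 : d.newtonSeq (k + 1) ∈ d.D := hball (hmem (k + 1))
    have hrem := d.norm_remainder_le d.ω_pos.le d.lipschitz hk hk1 hk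
    rw [sub_self, norm_zero, zero_add] at hrem
    have heq : d.F (d.newtonSeq (k + 1)) - d.F (d.newtonSeq k) -
        d.F' (d.newtonSeq k) (d.newtonSeq (k + 1) - d.newtonSeq k) = d.F (d.newtonSeq (k + 1)) := by
      rw [(hnewton.2 k).2]
      abel
    rw [heq] at hrem
    refine hrem.trans ?_
    have h1 := d.norm_step_le hball k
    have h2 := d.consts_fst_le hball k
    have h3 := norm_nonneg (d.newtonSeq (k + 1) - d.newtonSeq k)
    have h4 : ‖d.newtonSeq (k + 1) - d.newtonSeq k‖ ≤ d.α / 2 ^ k := h1.trans h2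
    have h5 : ‖d.newtonSeq (k + 1) - d.newtonSeq k‖ ^ 2 ≤ (d.α / 2 ^ k) ^ 2 :=
      pow_le_pow_left₀ h3 h4 2
    nlinarith [d.ω_pos]
  have hgeom : Tendsto (fun k : ℕ => d.α / 2 ^ k) atTop (𝓝 0) := by
    have h := (tendsto_pow_atTop_nhds_zero_of_lt_one (by norm_num : (0 : ℝ) ≤ 1 / 2)
      (by norm_num : (1 / 2 : ℝ) < 1)).const_mul d.α
    rw [mul_zero] at h
    refine h.congr fun k => ?_
    rw [one_div, inv_pow, div_eq_mul_inv]
  have hbd : Tendsto (fun k : ℕ => d.ω / 2 * (d.α / 2 ^ k) ^ 2) atTop (𝓝 0) := by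
    have := (hgeom.pow 2).const_mul (d.ω / 2)
    simpa using this
  have hto0 : Tendsto (fun k => d.G (d.F (d.newtonSeq (k + 1)))) atTop (𝓝 0) :=
    squeeze_zero_norm hres hbd
  have hcont : ContinuousAt (fun z => d.G (d.F z)) xstar :=
    d.G.continuous.continuousAt.comp (d.hasFDerivAt xstar (hball hstar)).continuousAt
  have hlim : Tendsto (fun k => d.G (d.F (d.newtonSeq (k + 1)))) atTop (𝓝 (d.G (d.F xstar))) :=
    hcont.tendsto.comp (hx.comp (tendsto_add_atTop_nat 1))
  have hzero : d.G (d.F xstar) = 0 := tendsto_nhds_unique hlim hto0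
  calc d.F xstar = d.F' d.x0 (d.G (d.F xstar)) := (d.G_right _).symm
    _ = 0 := by rw [hzero, map_zero]

/-! ### 5. Uniqueness in the larger ball -/

/-- `ρ₋ ≤ ρ₊`. [folklore] -/
private theorem rhoMinus_le_rhoPlus : d.rhoMinus ≤ d.rhoPlus := by
  unfold rhoMinus rhoPlus
  apply div_le_div_of_nonneg_right _ d.ω_pos.le
  linarith [Real.sqrt_nonneg (1 - 2 * d.h0)]

/-- `ρ₋ + ρ₊ = 2/ω̄₀`. [folklore] -/
private theorem rhoMinus_add_rhoPlus : d.rhoMinus + d.rhoPlus = 2 / d.ω := by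
  unfold rhoMinus rhoPlus
  rw [← add_div]
  congr 1
  ring

/-- **Uniqueness** (Deuflhard 2011, Rem. 2.1): a zero `x*` of `F` in the closed ball `S̄(x⁰, ρ₋)` is
the only zero of `F` in `S(x⁰, ρ₊) ∩ D`. [cite: Deuflhard2011, §2.1.1 Rem. 2.1] -/
theorem eq_of_zero_of_mem_ball {xstar y : X} (hstar : xstar ∈ closedBall d.x0 d.rhoMinus)
    (hstarD : xstar ∈ d.D) (hF0 : d.F xstar = 0) (hy : y ∈ ball d.x0 d.rhoPlus) (hyD : y ∈ d.D)
    (hFy : d.F y = 0) : y = xstar := by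
  have hrem := d.norm_remainder_le d.ω_pos.le d.lipschitz hstarD hyD d.x0_mem
  have hid : d.G (d.F y - d.F xstar - d.F' d.x0 (y - xstar)) = -(y - xstar) := by
    rw [map_sub, map_sub, hFy, hF0, d.G_left, map_zero]
    abel
  rw [hid, norm_neg] at hrem
  have h1 : ‖xstar - d.x0‖ ≤ d.rhoMinus := mem_closedBall_iff_norm.1 hstar
  have h2 : ‖y - d.x0‖ < d.rhoPlus := mem_ball_iff_norm.1 hy
  have hlt : d.ω / 2 * (‖xstar - d.x0‖ + ‖y - d.x0‖) < 1 := by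
    calc d.ω / 2 * (‖xstar - d.x0‖ + ‖y - d.x0‖) < d.ω / 2 * (d.rhoMinus + d.rhoPlus) :=
          mul_lt_mul_of_pos_left (by linarith) (half_pos d.ω_pos)
      _ = 1 := by
          have hω : d.ω ≠ 0 := d.ω_pos.ne'
          rw [rhoMinus_add_rhoPlus]
          field_simp
  rcases (norm_nonneg (y - xstar)).eq_or_lt with h0 | hpos
  · exact sub_eq_zero.1 (norm_eq_zero.1 h0.symm)
  · exfalso
    have hn : ‖y - xstar‖ * (1 - d.ω / 2 * (‖xstar - d.x0‖ + ‖y - d.x0‖)) ≤ 0 := by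
      nlinarith [hrem]
    have hp : 0 < ‖y - xstar‖ * (1 - d.ω / 2 * (‖xstar - d.x0‖ + ‖y - d.x0‖)) :=
      mul_pos hpos (sub_pos.2 hlt)
    linarith

end KantorovichData

/-- **Discharge of `NewtonKantorovich`** (Deuflhard 2011, Thm. 2.1; Kantorovich 1948).
[cite: Deuflhard2011, §2.1.1 Thm 2.1] -/
theorem NewtonKantorovich_holds : NewtonKantorovich := by
  intro X Y _ _ _ _ _ _ d hball
  exact d.newtonKantorovich hball

/-- **Discharge of `NewtonKantorovichUniqueness`** (Deuflhard 2011, Rem. 2.1; Kantorovich–Akilov;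
Ortega–Rheinboldt Thm. 12.6.2). [cite: Deuflhard2011, §2.1.1 Rem. 2.1] -/
theorem NewtonKantorovichUniqueness_holds : NewtonKantorovichUniqueness := by
  intro X Y _ _ _ _ _ _ d hballP
  have hball : closedBall d.x0 d.rhoMinus ⊆ d.D :=
    (closedBall_subset_closedBall d.rhoMinus_le_rhoPlus).trans hballP
  obtain ⟨x, -, -, xstar, hstar, hF0, -⟩ := d.newtonKantorovich hball
  exact ⟨xstar, hstar, hF0, fun y hy hFy =>
    d.eq_of_zero_of_mem_ball hstar (hball hstar) hF0 hy (hballP (ball_subset_closedBall hy)) hFy⟩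

end Literature.Analysis.Calculus

end
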